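import Summits.Ventures.GridStability.Models.RelativeSwingLFF

/-!
# GridStability/Models/RelativeSwingLFFOffDiag — the LFF bridge on the OFF-DIAGONAL line set (positive weights, for lit-6's closed-form certificates)

Cell `gridfusion` (LFF lane, lead P1 01:19:25Z / 01:35:18Z), seat gridfusion-model-1; continuation of
`Models/RelativeSwingLFF.lean` (p484338). lit-6's closed-form certificates (`LyapunovFunctionFamilyClosedForm`:
`swingClosedForm`, `relativeClosedForm`, p483522) require POSITIVE line weights `∀ k, 0 < w k`. The
all-ordered-pairs presentation of `RecastData.lffSystem` lists the DIAGONAL pairs `(i, i)` too — inert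
(their `E`-row is zero) but with weight `C_ii/2 = E_i²B_ii/2 ≤ 0`. This file removes them:

* `LffPair n = {k : Fin (n+1) × Fin (n+1) // k.1 ≠ k.2}` — off-diagonal ordered pairs (each physical
  line twice, once per orientation; `n(n+1)` lines, e.g. 6 for WSCC9's 3 machines);
* `lffEo`, `lffWo`, `lffδso`, `lffSystemOff` — the restricted presentation (same rows/weights/angles);
* `lffSystemOff_field_eq` — its vector field EQUALS that of `lffSystem` at every state (the dropped
  lines contribute nothing), hence
* `hasDerivWithinAt_lffState_off` — THE BRIDGE for `lffSystemOff` (from `hasDerivWithinAt_lffState`);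
* `lffEo_injective_aux` — `ker E = 0` still (the identity rows `(m+1, 0)` are off-diagonal);
* `lffWo_pos` — `0 < w` on every line iff `0 < C_ij = E_iE_jB_ij` for `i ≠ j` (positive transfer
  susceptances — `decide` per instance).
MODELLED column only (MV-2L + MV-λ); no certificate.
-/

noncomputable section

open Real Finset Matrix
open Literature.MathematicalPhysics.PowerSystems

namespace Summit.Ventures.GridStability.Models

namespace RecastData

variable {n : ℕ} (d : RecastData n)

/-- Off-diagonal ordered machine pairs (the physical lines, both orientations). -/
abbrev LffPair (n : ℕ) : Type := {k : Fin (n + 1) × Fin (n + 1) // k.1 ≠ k.2}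

/-- Line matrix restricted to off-diagonal pairs. -/
def lffEo (n : ℕ) : Matrix (LffPair n) (Fin n) ℝ := fun k m => lffE n k.1 m

/-- Weights restricted to off-diagonal pairs: `w_{(i,j)} = C_ij/2`. -/
def lffWo : LffPair n → ℝ := fun k => d.lffW k.1

/-- Equilibrium line angles restricted to off-diagonal pairs. -/
def lffδso (δs : Fin (n + 1) → ℝ) : LffPair n → ℝ := fun k => lffδs δs k.1

/-- lit-6's `relativeSwing` on the off-diagonal line set. MODELLED: MV-2L + MV-λ. -/
def lffSystemOff (lam : ℚ) (δs : Fin (n + 1) → ℝ) :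
    LyapunovFunctionFamily.System (Fin n ⊕ Fin n) (LffPair n) :=
  LyapunovFunctionFamily.System.relativeSwing (fun m => (d.M m.succ : ℝ)) (d.M 0 : ℝ) (lam : ℝ)
    (lffEo n) d.lffWo (lffδso δs)

/-- The diagonal rows of `lffE` vanish. -/
theorem lffE_diag (i : Fin (n + 1)) (m : Fin n) : lffE n (i, i) m = 0 := by
  simp [lffE]

/-- `(E' v)_k = (E v)_{k.1}`. -/
theorem lffEo_mulVec (v : Fin n → ℝ) (k : LffPair n) : (lffEo n *ᵥ v) k = (lffE n *ᵥ v) k.1 := rfl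

/-- Dropping the diagonal pairs does not change `Eᵀ g` when `g` is evaluated on the same rows. -/
theorem lffEo_transpose_mulVec (g : Fin (n + 1) × Fin (n + 1) → ℝ) (m : Fin n) :
    ((lffEo n)ᵀ *ᵥ fun k : LffPair n => g k.1) m = ((lffE n)ᵀ *ᵥ g) m := by
  simp only [mulVec, dotProduct, transpose_apply, lffEo]
  rw [← Finset.sum_subtype (univ.filter fun k : Fin (n + 1) × Fin (n + 1) => k.1 ≠ k.2)
    (fun k => by simp) (fun k => lffE n k m * g k), Finset.sum_filter]
  refine Finset.sum_congr rfl fun k _ => ?_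
  by_cases hk : k.1 = k.2
  · have : lffE n k m = 0 := by
      rcases k with ⟨i, j⟩
      simp only at hk
      subst hk
      exact lffE_diag i m
    simp [this]
  · simp [hk]

/-- The nonlinearity of the restricted system on any state is the restriction of the full one. -/
theorem lffSystemOff_nonlin (lam : ℚ) (δs : Fin (n + 1) → ℝ) (y : Fin n ⊕ Fin n → ℝ) (k : LffPair n) :
    (d.lffSystemOff lam δs).nonlin y k = (d.lffSystem lam δs).nonlin y k.1 := by
  simp only [LyapunovFunctionFamily.System.nonlin, lffSystemOff, lffSystem,
    LyapunovFunctionFamily.System.relativeSwing, LyapunovFunctionFamily.System.secondOrder_C_mulVec]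
  rfl

/-- **The restricted system has the same vector field** (at every state): the diagonal pairs are inert. -/
theorem lffSystemOff_field_eq (lam : ℚ) (δs : Fin (n + 1) → ℝ) (y : Fin n ⊕ Fin n → ℝ) :
    (d.lffSystemOff lam δs).field y = (d.lffSystem lam δs).field y := by
  funext idx
  rcases idx with m | m
  · rw [lffSystemOff, lffSystem, LyapunovFunctionFamily.System.relativeSwing,
      LyapunovFunctionFamily.System.relativeSwing, secondOrder_field_inl, secondOrder_field_inl]
  · rw [lffSystemOff, LyapunovFunctionFamily.System.relativeSwing, secondOrder_field_inr,
      ← LyapunovFunctionFamily.System.relativeSwing]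
    conv_rhs => rw [lffSystem, LyapunovFunctionFamily.System.relativeSwing, secondOrder_field_inr,
      ← LyapunovFunctionFamily.System.relativeSwing]
    congr 1
    rw [← mulVec_mulVec, ← mulVec_mulVec, ← mulVec_mulVec, ← mulVec_mulVec]
    congr 1
    funext m'
    have hW : Matrix.diagonal d.lffWo *ᵥ (d.lffSystemOff lam δs).nonlin y =
        fun k : LffPair n => (fun k' => d.lffW k' * (d.lffSystem lam δs).nonlin y k') k.1 := by
      funext k; simp [mulVec_diagonal, lffWo, lffSystemOff_nonlin]
    have hW' : Matrix.diagonal d.lffW *ᵥ (d.lffSystem lam δs).nonlin y =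
        fun k' => d.lffW k' * (d.lffSystem lam δs).nonlin y k' := by
      funext k; simp [mulVec_diagonal]
    simp only [lffSystemOff, lffSystem] at hW hW'
    rw [hW, hW']
    exact lffEo_transpose_mulVec (fun k' => d.lffW k' * (d.lffSystem lam δs).nonlin y k') m'

/-- **THE BRIDGE on the off-diagonal line set.** Same hypotheses and conclusion as
`hasDerivWithinAt_lffState`, for `lffSystemOff` (positive-weight presentation). -/
theorem hasDerivWithinAt_lffState_off (lam : ℚ) (a : ℝ) (hG : ∀ i j, i ≠ j → d.G i j = 0)
    (hB : ∀ i j, d.B i j = d.B j i) {δs : Fin (n + 1) → ℝ} (h : d.EqData δs)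
    (hM : ∀ i, d.M i ≠ 0) {c : ℝ → ClassicalSwing.State (n + 1)} {s : Set ℝ}
    (hc : (d.toModelRel lam a).IsSolutionOn c s) {t : ℝ} (ht : t ∈ s) :
    HasDerivWithinAt (fun τ => lffState δs (c τ))
      ((d.lffSystemOff lam δs).field (lffState δs (c t))) s t := by
  rw [lffSystemOff_field_eq]
  exact d.hasDerivWithinAt_lffState lam a hG hB h hM hc ht

/-- `ker E = 0` for the restricted line matrix: the identity rows `(m+1, 0)` are off-diagonal. -/
theorem lffEo_injective_aux (v : Fin n → ℝ) (hv : lffEo n *ᵥ v = 0) : v = 0 := by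
  funext m
  have hk : (m.succ, (0 : Fin (n + 1))).1 ≠ (m.succ, (0 : Fin (n + 1))).2 := Fin.succ_ne_zero m
  have h := congrFun hv ⟨(m.succ, 0), hk⟩
  rw [lffEo_mulVec] at h
  simp only [Pi.zero_apply] at h
  rw [lffE_mulVec_succ_zero] at h
  simpa using h

/-- `CB = 0` and observability for the restricted presentation (lit-6's generic facts). -/
theorem lffSystemOff_C_mul_B (lam : ℚ) (δs : Fin (n + 1) → ℝ) :
    (d.lffSystemOff lam δs).C * (d.lffSystemOff lam δs).B = 0 :=
  LyapunovFunctionFamily.System.relativeSwing_C_mul_B _ _ _ _ _ _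

/-- Observability (`ker E = 0`). -/
theorem lffSystemOff_obs (lam : ℚ) (δs : Fin (n + 1) → ℝ) (x : Fin n ⊕ Fin n → ℝ)
    (h1 : (d.lffSystemOff lam δs).C *ᵥ x = 0)
    (h2 : (d.lffSystemOff lam δs).C *ᵥ ((d.lffSystemOff lam δs).A *ᵥ x) = 0) : x = 0 :=
  LyapunovFunctionFamily.System.relativeSwing_obs _ _ _ _ _ _ (fun v hv => lffEo_injective_aux v hv) x h1 h2

/-- **Positive weights**: if every transfer coupling `C_ij = E_iE_jB_ij` (`i ≠ j`) is positive, every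
line of the restricted presentation has positive weight (`hw` of lit-6's closed forms). -/
theorem lffWo_pos (hC : ∀ i j : Fin (n + 1), i ≠ j → 0 < d.Cc i j) (k : LffPair n) : 0 < d.lffWo k := by
  have h := hC k.1.1 k.1.2 k.2
  simp only [lffWo, lffW]
  have : (0 : ℝ) < (d.Cc k.1.1 k.1.2 : ℝ) := by exact_mod_cast h
  linarith

/-- The equilibrium line angles of the restricted presentation are the relative-angle differences. -/
theorem lffSystemOff_δs (lam : ℚ) (δs : Fin (n + 1) → ℝ) (k : LffPair n) :
    (d.lffSystemOff lam δs).δs k = δs k.1.1 - δs k.1.2 := rfl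

end RecastData

end Summit.Ventures.GridStability.Models

end
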